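import Summits.QuantumAdvantage.QuantumAdvantage.Theorems.LinnikCubicClassGroupsDegreeOnePrimesEscapeDeuringSmoothedPrelims
import Summits.QuantumAdvantage.QuantumAdvantage.Theorems.LinnikCubicClassGroupsDegreeOnePrimesEscapeShortIntervalSmoothed
import HarnessLib

/-!
# The explicit inequality for a primitive Hecke character against a WINDOW weight

Topic `Summits/QuantumAdvantage/QuantumAdvantage/Theorems`, cell B2b-1 (linnik-cubic), PART A (gen 17);
helper toward the crux `DegreeOnePrimesEscape` (stmt-QuantumAdvantage-11543) of route
`LinnikCubicClassGroups` — the per-character input of the CHEBOTAREV DENSITY THEOREM IN SHORT INTERVALS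
(Hoheisel–Linnik range) for conjugacy classes.  HONEST FRAMING: the value of this file is a THEOREM
(kernel-checked lemma) — NOT summit progress (the route still rests on the hypothesis-type target
`PureCubicClassNumberHard`).

This is `…HeckeSmoothed.lean` / `…DeuringSmoothedPrelims.lean` (`norm_coefFordK_rcCoef_add_exc_le_of_zeros`,
Thorner–Zaman weight) with the WINDOW weight `g = windowTest lo hi ε` of `Literature/…/WindowWeight.lean`
(a smoothing of the indicator of `[lo, hi] = [log x, log(x+h)]` in `u = log n`, collars of length `ε`):
for a primitive ray class character `χ mod 𝔣` of a number field `K`, non-principal off `𝔣`, with entire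
continuations `L`, `L̄` of `L(χ,·)`, `L(χ̄,·)` whose zeros are dominated by those of `ζ₁_N`
(`ord_ρ L ≤ ord_ρ ζ₁_N`), and `F` the Laplace transform of `g`,

* `norm_rcEFRemainder_windowTest_zero_le` — the left-line integral:
  `‖J(0)‖ ≤ leftLineConst · C(n_K+1) · (log A + log 4 + 1) · e^{−(lo−ε)/2} (2M/ε)`, `A = |d_K|𝔑𝔣`;
* `norm_coefFordK_rcCoef_window_add_exc_le_of_zeros` — for a finite set `Exc` of non-trivial zeros of `L`
  and a bound `B` of the finite partial sums `Σ_{ρ ∉ Exc} m_{ζ₁_N}(ρ)‖F(−ρ)‖` over non-trivial zeros of `L`: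
  `‖K_χ(g) + Σ_{ρ ∈ Exc} m_L(ρ)F(−ρ)‖ ≤ B + 8(log A + 6n_K)(hi − lo + 2ε) + ‖J(0)‖-bound`.

References: [LagariasMontgomeryOdlyzko1979, §§3, 7]; [ThornerZaman2019, Lemma 4.3]; A. Balog, K. Ono,
J. Number Theory 91 (2001) (Chebotarev in short intervals); S. Gun, S. L. Naik, Monatsh. Math. (2024),
arXiv:2405.04698, Thm. 7 (the uniform short-interval Chebotarev theorem this chain certifies).
-/

noncomputable section

open Complex Real MeasureTheory Set Filter Topology NumberField NumberField.InfinitePlace IsDedekindDomain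
open scoped NumberField nonZeroDivisors

namespace Summit.QuantumAdvantage.QuantumAdvantage.Theorems.DegreeOnePrimesEscape

open Literature.NumberTheory.LFunctions Literature.NumberTheory.LFunctions.NumberField
  Literature.NumberTheory.LFunctions.EntireEF Literature.NumberTheory.LFunctions.WindowWeight

variable {K : Type} [Field K] [NumberField K]
variable {𝔪 : Ideal (𝓞 K)} {ψ : HeightOneSpectrum (𝓞 K) → ℂ} {p : Finset {w : InfinitePlace K // IsReal w}}

/-! ### The left-line integral against the window weight -/

/-- **`‖J(0)‖ ≤ leftLineConst · C(n_K+1) · (log(|d_K|𝔑𝔪) + log 4 + 1) · e^{−(lo−ε)/2} (2M/ε)`** for the window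
weight `windowTest lo hi ε` (`0 < ε < lo < hi`), with the constant `C` of
`exists_norm_logDeriv_continuation_left_le`. [cite: ThornerZaman2019, Lemma 4.3] -/
theorem norm_rcEFRemainder_windowTest_zero_le {C : ℝ} (hC0 : 0 < C)
    (hC : ∀ (K : Type) [Field K] [NumberField K] (𝔪 : Ideal (𝓞 K))
      (ψ : HeightOneSpectrum (𝓞 K) → ℂ) (p : Finset {w : InfinitePlace K // IsReal w}),
      IsRayClassCharacter 𝔪 ψ → IsPrimitive 𝔪 ψ → IsSignType 𝔪 ψ p → 𝔪 ≠ ⊥ →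
      ∀ (L L' : ℂ → ℂ), Differentiable ℂ L → (∀ s : ℂ, 1 < s.re → L s = rayClassLSeries 𝔪 ψ s) →
        Differentiable ℂ L' → (∀ s : ℂ, 1 < s.re → L' s = rayClassLSeries 𝔪 (star ψ) s) →
      ∀ t : ℝ, ‖logDeriv L (-1 / 2 + t * I)‖ ≤
        C * (Module.finrank ℚ K + 1) * (Real.log (|(discr K : ℝ)| * (Ideal.absNorm 𝔪 : ℝ)) + Real.log (|t| + 4)))
    (hψ : IsRayClassCharacter 𝔪 ψ) (hprim : IsPrimitive 𝔪 ψ) (hp : IsSignType 𝔪 ψ p) (h𝔪 : 𝔪 ≠ ⊥)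
    (hnt : ∃ v : HeightOneSpectrum (𝓞 K), ¬ 𝔪 ≤ v.asIdeal ∧ ψ v ≠ 1)
    {L L' : ℂ → ℂ} (hL : Differentiable ℂ L) (hLs : ∀ s : ℂ, 1 < s.re → L s = rayClassLSeries 𝔪 ψ s)
    (hL' : Differentiable ℂ L') (hL's : ∀ s : ℂ, 1 < s.re → L' s = rayClassLSeries 𝔪 (star ψ) s)
    {M : ℝ} (hM : ∀ y : ℝ, |iteratedDeriv 1 Real.smoothTransition y| ≤ M ∧ |iteratedDeriv 2 Real.smoothTransition y| ≤ M)
    {lo hi ε : ℝ} (hε : 0 < ε) (hεlo : ε < lo) (hlohi : lo < hi) :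
    ‖rcEFRemainder L (windowTest lo hi ε) 0‖ ≤
      NumberField.leftLineConst * (C * (Module.finrank ℚ K + 1)) *
        (Real.log (|(discr K : ℝ)| * (Ideal.absNorm 𝔪 : ℝ)) + Real.log 4 + 1) *
        (Real.exp (-((lo - ε) / 2)) * (2 * M / ε)) := by
  have hM0 : 0 ≤ M := le_trans (abs_nonneg _) (hM 0).1
  have hlogA : 0 ≤ Real.log (|(discr K : ℝ)| * (Ideal.absNorm 𝔪 : ℝ)) := by
    refine Real.log_nonneg ?_
    have h1 : (1 : ℝ) ≤ |(discr K : ℝ)| := by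
      have := Int.one_le_abs (discr_ne_zero K)
      rw [← Int.cast_abs]; exact_mod_cast this
    have h2 : (1 : ℝ) ≤ (Ideal.absNorm 𝔪 : ℝ) := by
      exact_mod_cast Nat.one_le_iff_ne_zero.mpr (by rwa [ne_eq, Ideal.absNorm_eq_zero_iff])
    nlinarith
  rw [rcEFRemainder]
  simp_rw [rcEFIntegrand]
  refine NumberField.norm_leftLine_integral_le (by positivity) ?_ (by positivity) (fun y ↦ ?_)
    (fun y ↦ norm_fordLaplace_windowTest_leftLine_le hM hε hεlo hlohi y) ?_
  · have : 0 ≤ Real.log 4 := Real.log_nonneg (by norm_num)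
    linarith
  · rw [norm_neg]
    have e : (((-(1 / 2) : ℝ) : ℂ) + y * I : ℂ) = -1 / 2 + y * I := by push_cast; ring
    rw [e]
    refine (hC K 𝔪 ψ p hψ hprim hp h𝔪 L L' hL hLs hL' hL's y).trans ?_
    have hlog4 : Real.log (|y| + 4) ≤ Real.log 4 + Real.log (1 + |y|) := by
      rw [← Real.log_mul (by norm_num) (by linarith [abs_nonneg y])]
      exact Real.log_le_log (by linarith [abs_nonneg y]) (by nlinarith [abs_nonneg y])
    have hl1 : 0 ≤ Real.log (1 + |y|) := Real.log_nonneg (by linarith [abs_nonneg y])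
    refine mul_le_mul_of_nonneg_left ?_ (by positivity)
    linarith
  · have hint := integrable_rcIntegrand_left hψ hprim hp h𝔪 hnt hL hLs hL' hL's
      (isSmoothedEFTest_windowTest hε hεlo.le hlohi.le) (windowTest_zero hε hεlo.le) (s := 0) (by simp)
    simp_rw [rcEFIntegrand] at hint
    exact hint.aestronglyMeasurable

/-! ### The per-character window inequality, zero sum dominated by `ζ₁_N` -/

/-- **The explicit inequality for a primitive Hecke character against the window weight, dominated by `ζ₁_N`.**
With `g = windowTest lo hi ε` (`0 < ε < lo < hi`), `F` its Laplace transform, `Exc` a finite set of non-trivial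
zeros of `L`, and `B` a bound for the finite partial sums `Σ_{ρ ∉ Exc} m_{ζ₁_N}(ρ)‖F(−ρ)‖` over non-trivial zeros
of `L`:
`‖K_χ(g) + Σ_{ρ ∈ Exc} m_L(ρ)F(−ρ)‖ ≤ B + 8(log A + 6n_K)(hi − lo + 2ε) + leftLineConst·C(n_K+1)(log A + log 4 + 1)e^{−(lo−ε)/2}(2M/ε)`.
[cite: LagariasMontgomeryOdlyzko1979, §7] [cite: ThornerZaman2019, Lemma 4.3] -/
theorem norm_coefFordK_rcCoef_window_add_exc_le_of_zeros (hψ : IsRayClassCharacter 𝔪 ψ)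
    (hprim : IsPrimitive 𝔪 ψ) (hp : IsSignType 𝔪 ψ p) (h𝔪 : 𝔪 ≠ ⊥)
    (hnt : ∃ v : HeightOneSpectrum (𝓞 K), ¬ 𝔪 ≤ v.asIdeal ∧ ψ v ≠ 1)
    {L L' : ℂ → ℂ} (hL : Differentiable ℂ L) (hLs : ∀ s : ℂ, 1 < s.re → L s = rayClassLSeries 𝔪 ψ s)
    (hL' : Differentiable ℂ L') (hL's : ∀ s : ℂ, 1 < s.re → L' s = rayClassLSeries 𝔪 (star ψ) s)
    {N : Type} [Field N] [NumberField N]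
    (hdom : ∀ ρ : ℂ, analyticOrderNatAt L ρ ≤ analyticOrderNatAt (dedekindZeta₁ N) ρ)
    {C : ℝ} (hC0 : 0 < C)
    (hC : ∀ (K : Type) [Field K] [NumberField K] (𝔪 : Ideal (𝓞 K))
      (ψ : HeightOneSpectrum (𝓞 K) → ℂ) (p : Finset {w : InfinitePlace K // IsReal w}),
      IsRayClassCharacter 𝔪 ψ → IsPrimitive 𝔪 ψ → IsSignType 𝔪 ψ p → 𝔪 ≠ ⊥ →
      ∀ (L L' : ℂ → ℂ), Differentiable ℂ L → (∀ s : ℂ, 1 < s.re → L s = rayClassLSeries 𝔪 ψ s) →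
        Differentiable ℂ L' → (∀ s : ℂ, 1 < s.re → L' s = rayClassLSeries 𝔪 (star ψ) s) →
      ∀ t : ℝ, ‖logDeriv L (-1 / 2 + t * I)‖ ≤
        C * (Module.finrank ℚ K + 1) * (Real.log (|(discr K : ℝ)| * (Ideal.absNorm 𝔪 : ℝ)) + Real.log (|t| + 4)))
    {M : ℝ} (hM : ∀ y : ℝ, |iteratedDeriv 1 Real.smoothTransition y| ≤ M ∧ |iteratedDeriv 2 Real.smoothTransition y| ≤ M)
    {lo hi ε : ℝ} (hε : 0 < ε) (hεlo : ε < lo) (hlohi : lo < hi)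
    (Exc : Finset ℂ) (hExc : ∀ ρ ∈ Exc, L ρ = 0 ∧ 0 < ρ.re ∧ ρ.re < 1)
    {B : ℝ} (hB : ∀ u : Finset ℂ, (∀ ρ ∈ u, L ρ = 0 ∧ 0 < ρ.re ∧ ρ.re < 1) →
      ∑ ρ ∈ u with ρ ∉ Exc, (analyticOrderNatAt (dedekindZeta₁ N) ρ : ℝ) *
        ‖fordLaplace (windowTest lo hi ε) (-ρ)‖ ≤ B) :
    ‖coefFordK (rcCoef 𝔪 ψ) (windowTest lo hi ε) 0 +
        ∑ ρ ∈ Exc, (analyticOrderNatAt L ρ : ℂ) * fordLaplace (windowTest lo hi ε) (-ρ)‖ ≤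
      B + 8 * (Real.log (|(discr K : ℝ)| * (Ideal.absNorm 𝔪 : ℝ)) + 6 * Module.finrank ℚ K) * (hi - lo + 2 * ε) +
        NumberField.leftLineConst * (C * (Module.finrank ℚ K + 1)) *
          (Real.log (|(discr K : ℝ)| * (Ideal.absNorm 𝔪 : ℝ)) + Real.log 4 + 1) *
          (Real.exp (-((lo - ε) / 2)) * (2 * M / ε)) := by
  classical
  set g := windowTest lo hi ε with hg
  have hadm := isSmoothedEFTest_windowTest (a := lo) (b := hi) hε hεlo.le hlohi.le
  have hg0 : g 0 = 0 := windowTest_zero hε hεlo.le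
  have hF0 : ‖fordLaplace₀ g 0‖ ≤ hi - lo + 2 * ε := by
    rw [fordLaplace₀_eq_fordLaplace hg0]
    have h := norm_fordLaplace_windowTest_le₀ (a := lo) (b := hi) hε hεlo.le hlohi.le 0
    rwa [wEdge_zero, one_mul] at h
  have hsz : ∀ ρ : ℂ, L ρ = 0 → 0 < ρ.re → ρ.re < 1 → ρ ≠ 0 := by
    intro ρ _ h1 _ h; rw [h] at h1; simp at h1
  have hexpl := rcCoefFordK_eq_explicit hψ hprim hp h𝔪 hnt hL hLs hL' hL's hadm hg0 (s := 0)
    (by norm_num) (by norm_num) hsz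
  have hsum := summable_norm_rcZeroTerm hψ hprim hp h𝔪 hnt hL hLs hL' hL's hadm (s := 0) (by norm_num) hsz
  have hB' : ∀ u : Finset ℂ, (∀ ρ ∈ u, L ρ = 0 ∧ 0 < ρ.re ∧ ρ.re < 1) →
      ∑ ρ ∈ u with ρ ∉ Exc, (analyticOrderNatAt L ρ : ℝ) * ‖fordLaplace g (-ρ)‖ ≤ B := by
    intro u hu
    refine le_trans (Finset.sum_le_sum fun ρ _ ↦ ?_) (hB u hu)
    exact mul_le_mul_of_nonneg_right (by exact_mod_cast hdom ρ) (norm_nonneg _)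
  have hcore := norm_explicit_core (f := L) hg0 (Kv := coefFordK (rcCoef 𝔪 ψ) g 0) (main := 0)
    (J := rcEFRemainder L g 0) hsum (by rw [hexpl]; ring) hF0 Exc hExc hB'
  rw [sub_zero] at hcore
  have hm₀ := analyticOrderNatAt_continuation_zero_le hψ hprim hp h𝔪 hnt hL hLs
  have hJ := norm_rcEFRemainder_windowTest_zero_le hC0 hC hψ hprim hp h𝔪 hnt hL hLs hL' hL's hM hε hεlo hlohi
  have hℓ0 : 0 ≤ hi - lo + 2 * ε := by linarith
  have hm₀' : (analyticOrderNatAt L 0 : ℝ) * (hi - lo + 2 * ε) ≤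
      8 * (Real.log (|(discr K : ℝ)| * (Ideal.absNorm 𝔪 : ℝ)) + 6 * Module.finrank ℚ K) * (hi - lo + 2 * ε) :=
    mul_le_mul_of_nonneg_right hm₀ hℓ0
  linarith

end Summit.QuantumAdvantage.QuantumAdvantage.Theorems.DegreeOnePrimesEscape

end
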